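import Summits.BirchSwinnertonDyer.Rank1Residual.Iwasawa.LambdaInvariantValuation
import Mathlib.RingTheory.Polynomial.Cyclotomic.Eval
import HarnessLib

/-!
# The valuation of `G(ζ − 1)` at `p`-power roots of unity for `G ∈ Λ ∖ {0}`:
# `v_p(G(ζ − 1)) = μ(G) + λ(G)/φ(pⁿ⁺¹)` when `λ(G) < φ(pⁿ⁺¹)`, and the ONE-VALUE CERTIFICATE
# `|G(ζ − 1)| > 1/p ⟹ μ(G) = 0 ∧ λ(G) = φ(pⁿ⁺¹)·v_p(G(ζ − 1))`
# (cell `b2b-bsdres`; class-agnostic kernel support for the (μ, λ) censuses of iw-1 / iw-2 and for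
# iw-2's ENGINE T; prover unit `b2b-bsdres-additive-p3`, gen 10; part 2/4)

HONEST FRAMING (run/shared/lean/b2b/bsd-rank1-residual/, verbatim in every file): the goal of the
cell is to DELETE the COMBINATION-SHAPED residual classes of the Birch–Swinnerton-Dyer formula for
ALL analytic-rank `≤ 1` elliptic curves over `ℚ` — "full BSD formula for every rank `≤ 1` curve in
class `C`" assembled STRICTLY from published theorems — so that the rank-`≤ 1` remainder becomes
exactly the CONSTRUCTION-SHAPED classes, which are TYPED (missing-input `Prop`s), NOT attempted.
This is not "finishing BSD". THEOREMS ONLY (pure `p`-adic algebra); no definition, no named fact;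
nothing about any curve is asserted; nothing booked; no label changes.

## What this file proves (part 1 = `Iwasawa/LambdaInvariantValuation.lean`: for `G ∈ Λ ∖ {0}` and
`|z| < 1`, `|G(z)| = p^{−μ(G)}·|z|^{λ(G)}` whenever `|z|^{λ(G)} > 1/p`, and `|G(z)| > 1/p` forces
`μ(G) = 0`, `|G(z)| = |z|^{λ(G)}`)

* §4 roots of unity: for `ζ ∈ ℂ_p` of order `pⁿ⁺¹`, all `|ζ' − 1|` (`ζ'` of the same order) are
  equal and **`|ζ − 1|^{φ(pⁿ⁺¹)} = 1/p`** (`Φ_{pⁿ⁺¹}(1) = p`), so `1/p < |ζ − 1|^d ↔ d < φ(pⁿ⁺¹)`;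
* §5 **LAYER FORM AND THE CERTIFICATE**: for `G ≠ 0` and `ζ` of order `pⁿ⁺¹`,
  - `λ(G) < φ(pⁿ⁺¹)` ⇒ `|G(ζ − 1)| = p^{−μ(G)}·|ζ − 1|^{λ(G)}`, i.e.
    `|G(ζ − 1)|^{φ(pⁿ⁺¹)} = p^{−(φ(pⁿ⁺¹)·μ(G) + λ(G))}`, `v_p(G(ζ − 1)) = μ(G) + λ(G)/φ(pⁿ⁺¹)`
    (`norm_tsum_eq_of_lam_lt_totient`, `norm_tsum_pow_totient_eq_of_lam_lt_totient`);
  - **`|G(ζ − 1)| > 1/p` ⇒ `μ(G) = 0`, `λ(G) < φ(pⁿ⁺¹)` and `|G(ζ − 1)|^{φ(pⁿ⁺¹)} = p^{−λ(G)}`**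
    (`mu_eq_zero_and_lam_lt_totient_of_lt_norm_tsum`): ONE value of `G` at ONE point of ONE layer
    determines `μ = 0` and `λ` exactly — integer form: `|G(ζ − 1)|^{φ(pⁿ⁺¹)} = p^{−V}` with
    `V < φ(pⁿ⁺¹)` ⇒ `μ(G) = 0 ∧ λ(G) = V` (`mu_eq_zero_and_lam_eq_of_norm_tsum_pow_eq`);
  - the complementary regime: `|G(ζ − 1)| ≤ 1/p ↔ (μ(G) ≥ 1 ∨ λ(G) ≥ φ(pⁿ⁺¹))`
    (`norm_tsum_le_iff_one_le_mu_or_totient_le_lam`);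
  - consistency across layers: `μ(G) = 0`, `λ(G) ≤ p − 2` ⇒ EVERY layer `k` reads
    `|G(ζ_k − 1)|^{φ(pᵏ⁺¹)} = p^{−λ(G)}` (`norm_tsum_pow_totient_eq_of_lam_add_two_le`).
  This is, word for word, the validity rule of the cell's modular-symbol-free ENGINE T
  (HOME/b2b-bsdres-iw-2/ENGINE-T.md §0: "`V := v_p(Norm S_ψ) ≤ e_n − 1 ⟹ μ(θ_n) = 0` and
  `λ(θ_n) = V`; `V ≥ e_n ⟹` undetermined (`λ(θ_n) ≥ e_n` or `μ(θ_n) > 0`)", `e_n = φ(pⁿ)`) and of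
  MU-CERTIFICATES §1 ("same logic"), now a kernel theorem about any `G ∈ Λ ∖ {0}`. The product over
  the `φ(pⁿ⁺¹)` points of a layer (ENGINE T's field norm `Norm S_ψ`) and the arithmetic instances
  (Birch sums = twisted special values of `p`-adic `L`-functions and of Mazur–Tate elements;
  Sprung's `L♯/L♭` on class X8) are in `Iwasawa/LambdaInvariantValuationTwisted.lean` and
  `Supersingular/MazurTateValuation.lean`.

References (ATTRIBUTION of classical statements; proofs self-contained): [Washington1997] §7.1–7.2
(Prop. 7.2, Thm. 7.3); [Lang1990] Ch. 5 §2 Thm. 2.2 (PDF p. 97); [Pollack2003] Prop. 6.9–6.10;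
HOME/b2b-bsdres-additive-p3/X8-ROUTE-B.md §15 (gen 10).
-/

set_option autoImplicit false

noncomputable section

open scoped Classical

open Polynomial Literature.NumberTheory.EllipticCurves
  Summit.BirchSwinnertonDyer.Rank1Residual.X1.MuLambda

namespace Summit.BirchSwinnertonDyer.Rank1Residual.Iwasawa

variable {p : ℕ} [hp : Fact p.Prime]

/-! ## §4. `p`-power roots of unity: `|ζ − 1|^{φ(pⁿ⁺¹)} = 1/p` -/

section RootsOfUnity

/-- `|ζ^a − 1| ≤ |ζ − 1|` for `|ζ| = 1` (`ζ^a − 1 = (ζ − 1)(1 + ζ + ⋯ + ζ^{a−1})`). [folklore] -/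
theorem norm_pow_sub_one_le {ζ : ℂ_[p]} (hζ : ‖ζ‖ = 1) (a : ℕ) : ‖ζ ^ a - 1‖ ≤ ‖ζ - 1‖ := by
  have hgeom : (∑ i ∈ Finset.range a, ζ ^ i) * (ζ - 1) = ζ ^ a - 1 := geom_sum_mul ζ a
  rw [← hgeom, norm_mul]
  refine mul_le_of_le_one_left (norm_nonneg _) ?_
  refine IsUltrametricDist.norm_sum_le_of_forall_le_of_nonneg zero_le_one fun i _ ↦ ?_
  rw [norm_pow, hζ, one_pow]

/-- **All primitive `pⁿ⁺¹`-th roots of unity are equidistant from `1`**: `|ζ' − 1| = |ζ − 1|`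
(each is a power of the other). [folklore] -/
theorem norm_sub_one_eq_of_isPrimitiveRoot {n : ℕ} {ζ ζ' : ℂ_[p]}
    (hζ : IsPrimitiveRoot ζ (p ^ (n + 1))) (hζ' : IsPrimitiveRoot ζ' (p ^ (n + 1))) :
    ‖ζ' - 1‖ = ‖ζ - 1‖ := by
  have hk : p ^ (n + 1) ≠ 0 := pow_ne_zero _ hp.out.ne_zero
  have h1 : ‖ζ‖ = 1 := norm_eq_one_of_pow_eq_one_padicComplex hk hζ.pow_eq_one
  have h1' : ‖ζ'‖ = 1 := norm_eq_one_of_pow_eq_one_padicComplex hk hζ'.pow_eq_one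
  obtain ⟨a, -, rfl⟩ := hζ.eq_pow_of_pow_eq_one hζ'.pow_eq_one
  refine le_antisymm (norm_pow_sub_one_le h1 a) ?_
  obtain ⟨b, -, hb⟩ := hζ'.eq_pow_of_pow_eq_one hζ.pow_eq_one
  conv_lhs => rw [← hb]
  exact norm_pow_sub_one_le h1' b

/-- **`|ζ − 1|^{φ(pⁿ⁺¹)} = 1/p`** for `ζ ∈ ℂ_p` of order `pⁿ⁺¹`: `p = Φ_{pⁿ⁺¹}(1) = ∏_{ζ'} (1 − ζ')`
over the `φ(pⁿ⁺¹)` primitive roots `ζ'` (Mathlib `eval_one_cyclotomic_prime_pow`,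
`cyclotomic_eq_prod_X_sub_primitiveRoots`), all factors of the same absolute value. [folklore] -/
theorem norm_sub_one_pow_totient_eq {n : ℕ} {ζ : ℂ_[p]} (hζ : IsPrimitiveRoot ζ (p ^ (n + 1))) :
    ‖ζ - 1‖ ^ Nat.totient (p ^ (n + 1)) = (p : ℝ)⁻¹ := by
  have hpos : 0 < p ^ (n + 1) := pow_pos hp.out.pos _
  -- `Φ_{p^{n+1}} = ∏ (X - ζ')` and `Φ_{p^{n+1}}(1) = p`
  have hprod := cyclotomic_eq_prod_X_sub_primitiveRoots hζ
  have heval : ((cyclotomic (p ^ (n + 1)) ℂ_[p]).eval 1) = (p : ℂ_[p]) :=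
    eval_one_cyclotomic_prime_pow n
  rw [hprod, eval_prod] at heval
  simp only [eval_sub, eval_X, eval_C] at heval
  have hnorm := congr_arg (‖·‖) heval
  simp only [norm_prod] at hnorm
  -- `‖(p : ℂ_p)‖ = 1/p` (also `Literature.NumberTheory.LFunctions.Dwork.norm_natCast_p_padicComplex`)
  have hnp : ‖(p : ℂ_[p])‖ = (p : ℝ)⁻¹ := by
    have h := norm_algebraMap_comp_natCast_pow (p := p) 1
    rwa [pow_one, pow_one, map_natCast] at h
  rw [hnp] at hnorm
  rw [← hnorm, ← hζ.card_primitiveRoots, ← Finset.prod_const]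
  refine Finset.prod_congr rfl fun ζ' hζ' ↦ ?_
  rw [mem_primitiveRoots hpos] at hζ'
  rw [norm_sub_rev (1 : ℂ_[p]) ζ', norm_sub_one_eq_of_isPrimitiveRoot hζ hζ']

/-- `0 < |ζ − 1| < 1` for `ζ` of order `pⁿ⁺¹`. [folklore] -/
theorem norm_sub_one_pos_and_lt_one {n : ℕ} {ζ : ℂ_[p]} (hζ : IsPrimitiveRoot ζ (p ^ (n + 1))) :
    0 < ‖ζ - 1‖ ∧ ‖ζ - 1‖ < 1 :=
  ⟨norm_pos_iff.mpr (sub_one_ne_zero_of_isPrimitiveRoot' hζ),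
    norm_sub_one_lt_one_of_pow_prime_pow_eq_one (j := n + 1) hζ.pow_eq_one⟩
where
  /-- `ζ ≠ 1`. [folklore] -/
  sub_one_ne_zero_of_isPrimitiveRoot' {n : ℕ} {ζ : ℂ_[p]}
      (hζ : IsPrimitiveRoot ζ (p ^ (n + 1))) : ζ - 1 ≠ 0 := by
    rw [sub_ne_zero]
    intro h1
    have hone : (p ^ (n + 1) : ℕ) = 1 := hζ.eq_orderOf.trans (by rw [h1, orderOf_one])
    have : 1 < p ^ (n + 1) := Nat.one_lt_pow (Nat.succ_ne_zero n) hp.out.one_lt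
    omega

/-- **`1/p < |ζ − 1|^d ↔ d < φ(pⁿ⁺¹)`** for `ζ` of order `pⁿ⁺¹` (`|ζ − 1| < 1` and
`|ζ − 1|^{φ(pⁿ⁺¹)} = 1/p`). [folklore] -/
theorem inv_lt_norm_sub_one_pow_iff {n : ℕ} {ζ : ℂ_[p]} (hζ : IsPrimitiveRoot ζ (p ^ (n + 1)))
    (d : ℕ) : (p : ℝ)⁻¹ < ‖ζ - 1‖ ^ d ↔ d < Nat.totient (p ^ (n + 1)) := by
  obtain ⟨h0, h1⟩ := norm_sub_one_pos_and_lt_one hζ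
  rw [← norm_sub_one_pow_totient_eq hζ]
  exact pow_lt_pow_iff_right_of_lt_one₀ h0 h1

/-- `|ζ − 1|^d ≤ 1/p ↔ φ(pⁿ⁺¹) ≤ d`. [folklore] -/
theorem norm_sub_one_pow_le_inv_iff {n : ℕ} {ζ : ℂ_[p]} (hζ : IsPrimitiveRoot ζ (p ^ (n + 1)))
    (d : ℕ) : ‖ζ - 1‖ ^ d ≤ (p : ℝ)⁻¹ ↔ Nat.totient (p ^ (n + 1)) ≤ d := by
  rw [← not_lt, inv_lt_norm_sub_one_pow_iff hζ, not_lt]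

end RootsOfUnity

/-! ## §5. Layer form: `v_p(G(ζ − 1)) = μ(G) + λ(G)/φ(pⁿ⁺¹)` and the one-value certificate -/

section Layer

/-- **Valuation of `G(ζ − 1)`**: for `G ∈ Λ ∖ {0}`, `ζ ∈ ℂ_p` of order `pⁿ⁺¹` and
`λ(G) < φ(pⁿ⁺¹)`: `|G(ζ − 1)| = p^{-μ(G)} · |ζ − 1|^{λ(G)}`. [cite: Washington1997, §7.1–7.2 and Thm. 7.3] -/
theorem norm_tsum_eq_of_lam_lt_totient {G : IwasawaAlgebra p} (hG0 : G ≠ 0) {n : ℕ} {ζ : ℂ_[p]}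
    (hζ : IsPrimitiveRoot ζ (p ^ (n + 1))) (hlam : lam G < Nat.totient (p ^ (n + 1))) :
    ‖∑' k, ((algebraMap ℚ_[p] ℂ_[p]).comp (algebraMap ℤ_[p] ℚ_[p])) (PowerSeries.coeff k G) *
        (ζ - 1) ^ k‖ = ((p : ℝ)⁻¹) ^ mu G * ‖ζ - 1‖ ^ lam G :=
  norm_tsum_eq_of_lt_norm_pow_lam hG0 (norm_sub_one_pos_and_lt_one hζ).2
    ((inv_lt_norm_sub_one_pow_iff hζ _).mpr hlam)

/-- **Same, raised to the power `φ(pⁿ⁺¹)`** (the form an engine reads as an INTEGER valuation of a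
field norm): `λ(G) < φ(pⁿ⁺¹)` ⇒ `|G(ζ − 1)|^{φ(pⁿ⁺¹)} = p^{−(φ(pⁿ⁺¹)·μ(G) + λ(G))}`.
[cite: Washington1997, §7.1–7.2 and Thm. 7.3] -/
theorem norm_tsum_pow_totient_eq_of_lam_lt_totient {G : IwasawaAlgebra p} (hG0 : G ≠ 0) {n : ℕ}
    {ζ : ℂ_[p]} (hζ : IsPrimitiveRoot ζ (p ^ (n + 1))) (hlam : lam G < Nat.totient (p ^ (n + 1))) :
    ‖∑' k, ((algebraMap ℚ_[p] ℂ_[p]).comp (algebraMap ℤ_[p] ℚ_[p])) (PowerSeries.coeff k G) *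
        (ζ - 1) ^ k‖ ^ Nat.totient (p ^ (n + 1)) =
      ((p : ℝ)⁻¹) ^ (Nat.totient (p ^ (n + 1)) * mu G + lam G) := by
  rw [norm_tsum_eq_of_lam_lt_totient hG0 hζ hlam, mul_pow, ← pow_mul,
    show (‖ζ - 1‖ ^ lam G) ^ Nat.totient (p ^ (n + 1)) =
        (‖ζ - 1‖ ^ Nat.totient (p ^ (n + 1))) ^ lam G by rw [← pow_mul, ← pow_mul, mul_comm],
    norm_sub_one_pow_totient_eq hζ, ← pow_add]
  congr 1
  ring

/-- **THE ONE-VALUE CERTIFICATE at a layer** (ENGINE T's and MU-CERTIFICATES' validity rule as a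
theorem about any `G ∈ Λ ∖ {0}`): if **`|G(ζ − 1)| > 1/p`** for ONE `ζ` of order `pⁿ⁺¹`, then
`μ(G) = 0`, `λ(G) < φ(pⁿ⁺¹)` and `|G(ζ − 1)|^{φ(pⁿ⁺¹)} = p^{−λ(G)}` — i.e.
`λ(G) = φ(pⁿ⁺¹)·v_p(G(ζ − 1))`. [cite: Washington1997, §7.1–7.2 and Thm. 7.3] -/
theorem mu_eq_zero_and_lam_lt_totient_of_lt_norm_tsum {G : IwasawaAlgebra p} (hG0 : G ≠ 0) {n : ℕ}
    {ζ : ℂ_[p]} (hζ : IsPrimitiveRoot ζ (p ^ (n + 1)))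
    (h : (p : ℝ)⁻¹ < ‖∑' k, ((algebraMap ℚ_[p] ℂ_[p]).comp (algebraMap ℤ_[p] ℚ_[p]))
      (PowerSeries.coeff k G) * (ζ - 1) ^ k‖) :
    mu G = 0 ∧ lam G < Nat.totient (p ^ (n + 1)) ∧
      ‖∑' k, ((algebraMap ℚ_[p] ℂ_[p]).comp (algebraMap ℤ_[p] ℚ_[p])) (PowerSeries.coeff k G) *
        (ζ - 1) ^ k‖ ^ Nat.totient (p ^ (n + 1)) = ((p : ℝ)⁻¹) ^ lam G := by
  obtain ⟨hμ, hlt, -⟩ := mu_eq_zero_of_lt_norm_tsum hG0 (norm_sub_one_pos_and_lt_one hζ).2 h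
  have hlam : lam G < Nat.totient (p ^ (n + 1)) := (inv_lt_norm_sub_one_pow_iff hζ _).mp hlt
  refine ⟨hμ, hlam, ?_⟩
  rw [norm_tsum_pow_totient_eq_of_lam_lt_totient hG0 hζ hlam, hμ, mul_zero, zero_add]

/-- **Integer form of the certificate**: if `|G(ζ − 1)|^{φ(pⁿ⁺¹)} = p^{−V}` with `V < φ(pⁿ⁺¹)`
(`V` = the `p`-adic valuation of the layer's field norm), then `μ(G) = 0` and `λ(G) = V`.
[cite: Washington1997, §7.1–7.2 and Thm. 7.3] -/
theorem mu_eq_zero_and_lam_eq_of_norm_tsum_pow_eq {G : IwasawaAlgebra p} (hG0 : G ≠ 0) {n : ℕ}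
    {ζ : ℂ_[p]} (hζ : IsPrimitiveRoot ζ (p ^ (n + 1))) {V : ℕ} (hV : V < Nat.totient (p ^ (n + 1)))
    (h : ‖∑' k, ((algebraMap ℚ_[p] ℂ_[p]).comp (algebraMap ℤ_[p] ℚ_[p])) (PowerSeries.coeff k G) *
        (ζ - 1) ^ k‖ ^ Nat.totient (p ^ (n + 1)) = ((p : ℝ)⁻¹) ^ V) :
    mu G = 0 ∧ lam G = V := by
  obtain ⟨hq0, hq1⟩ := inv_prime_pos_and_lt_one (p := p)
  have hφ : Nat.totient (p ^ (n + 1)) ≠ 0 := (Nat.totient_pos.mpr (pow_pos hp.out.pos _)).ne'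
  -- `|G(ζ-1)| > 1/p` because its `φ`-th power `p^{-V}` exceeds `p^{-φ}`
  have hgt : (p : ℝ)⁻¹ < ‖∑' k, ((algebraMap ℚ_[p] ℂ_[p]).comp (algebraMap ℤ_[p] ℚ_[p]))
      (PowerSeries.coeff k G) * (ζ - 1) ^ k‖ := by
    by_contra hle
    rw [not_lt] at hle
    have h1 : ‖∑' k, ((algebraMap ℚ_[p] ℂ_[p]).comp (algebraMap ℤ_[p] ℚ_[p]))
        (PowerSeries.coeff k G) * (ζ - 1) ^ k‖ ^ Nat.totient (p ^ (n + 1)) ≤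
        ((p : ℝ)⁻¹) ^ Nat.totient (p ^ (n + 1)) :=
      pow_le_pow_left₀ (norm_nonneg _) hle _
    rw [h] at h1
    exact absurd ((pow_lt_pow_iff_right_of_lt_one₀ hq0 hq1).mpr hV) (not_lt.mpr h1)
  obtain ⟨hμ, -, hpow⟩ := mu_eq_zero_and_lam_lt_totient_of_lt_norm_tsum hG0 hζ hgt
  refine ⟨hμ, ?_⟩
  rw [h] at hpow
  exact (pow_right_injective₀ hq0 hq1.ne hpow).symm

/-- **The undetermined regime, both ways**: `|G(ζ − 1)| ≤ 1/p ↔ (μ(G) ≥ 1 ∨ λ(G) ≥ φ(pⁿ⁺¹))`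
(ENGINE-T.md: "`V ≥ e_n ⟹` undetermined at this layer (`λ(θ_n) ≥ e_n` or `μ(θ_n) > 0`)").
[cite: Washington1997, §7.1–7.2 and Thm. 7.3] -/
theorem norm_tsum_le_iff_one_le_mu_or_totient_le_lam {G : IwasawaAlgebra p} (hG0 : G ≠ 0) {n : ℕ}
    {ζ : ℂ_[p]} (hζ : IsPrimitiveRoot ζ (p ^ (n + 1))) :
    ‖∑' k, ((algebraMap ℚ_[p] ℂ_[p]).comp (algebraMap ℤ_[p] ℚ_[p])) (PowerSeries.coeff k G) *
        (ζ - 1) ^ k‖ ≤ (p : ℝ)⁻¹ ↔ 1 ≤ mu G ∨ Nat.totient (p ^ (n + 1)) ≤ lam G := by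
  have hz := (norm_sub_one_pos_and_lt_one hζ).2
  rw [← norm_sub_one_pow_le_inv_iff hζ]
  exact ⟨one_le_mu_or_pow_lam_le_of_norm_tsum_le hG0 hz,
    norm_tsum_le_of_one_le_mu_or_pow_lam_le hG0 hz⟩

/-- **Lower layers of the same `G`**: at `ζ` of order `pᵏ⁺¹` with `λ(G) < φ(pᵏ⁺¹)` the valuation is
`μ(G) + λ(G)/φ(pᵏ⁺¹)`; so once `μ(G) = 0` and `λ(G) < p − 1`, EVERY layer `k` reads `λ(G)` as
`φ(pᵏ⁺¹)·v_p(G(ζ_k − 1))` (consistency check across layers used by the engines).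
[cite: Washington1997, §7.1–7.2 and Thm. 7.3] -/
theorem norm_tsum_pow_totient_eq_of_lam_add_two_le {G : IwasawaAlgebra p} (hG0 : G ≠ 0)
    (hμ : mu G = 0) (hsmall : lam G + 2 ≤ p) {k : ℕ} {ζ : ℂ_[p]}
    (hζ : IsPrimitiveRoot ζ (p ^ (k + 1))) :
    ‖∑' i, ((algebraMap ℚ_[p] ℂ_[p]).comp (algebraMap ℤ_[p] ℚ_[p])) (PowerSeries.coeff i G) *
        (ζ - 1) ^ i‖ ^ Nat.totient (p ^ (k + 1)) = ((p : ℝ)⁻¹) ^ lam G := by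
  have hlam : lam G < Nat.totient (p ^ (k + 1)) := by
    calc lam G < p - 1 := by omega
      _ = Nat.totient (p ^ 1) := by rw [pow_one, Nat.totient_prime hp.out]
      _ ≤ Nat.totient (p ^ (k + 1)) := by
          rw [Nat.totient_prime_pow hp.out one_pos, Nat.totient_prime_pow hp.out (Nat.succ_pos k)]
          exact Nat.mul_le_mul_right _ (Nat.pow_le_pow_right hp.out.pos (by omega))
  rw [norm_tsum_pow_totient_eq_of_lam_lt_totient hG0 hζ hlam, hμ, mul_zero, zero_add]

end Layer

end Summit.BirchSwinnertonDyer.Rank1Residual.Iwasawa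

end
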